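import Literature.AlgebraicGeometry.Frobenioids.ModelFrobenioidFunctor
import Literature.AlgebraicGeometry.Frobenioids.RationalFunctionSubfunctors
import HarnessLib

/-!
# Frobenioids I, §5: functoriality of the model Frobenioid in its data — the "natural functors" of
# Proposition 5.3 between `C^un-tr`, `(C^un-tr)^pf`, `C^rlf` in their model descriptions

Mochizuki, *The geometry of Frobenioids I: the general theory*, Kyushu J. Math. **62** (2008)
293–400, §5, Theorem 5.2 (i) p. 100 and Proposition 5.3 p. 103 [cite: MochizukiFrdI2008, Thm. 5.2 (i) p.100]
[cite: MochizukiFrdI2008, Prop. 5.3 p.103].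

Proposition 5.3 (p. 103) describes `C^un-tr`, `(C^un-tr)^pf`, `C^rlf` as the model Frobenioids
(Thm. 5.2) of the data `(Φ, Φ^birat)`, `(Φ^pf, (Φ^birat)^pf)`, `(Φ^rlf, ℝ · Φ^birat)` and asserts a
"natural 1-commutative diagram of functors … `C^un-tr → (C^un-tr)^pf → C^rlf` [where … the remaining
functors are the functors that arise naturally from the construction of the 'unit-trivialization',
'perfection', and 'realification']". This file makes "arise naturally from the construction"
precise for model Frobenioids:
* `ModelFrobenioid.DataHom` — a morphism of model data `(Φ, B, Div_B) → (Φ', B', Div_B')`: homomorphisms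
  of monoids on `D`, `η : Φ → Φ'`, `β : B → B'`, with `Div_B' ∘ β = η^gp ∘ Div_B`;
  `DataHom.functor` — the induced functor of model Frobenioids `(A_D, α) ↦ (A_D, η^gp(α))`,
  `(d, f, Div, u) ↦ (d, f, η(Div), β(u))` (relation (d) of Thm. 5.2 (i) is transported; PROVED), and
  `DataHom.functorCompToElem` — its compatibility with the functors to `F_Φ`, `F_{Φ'}`.
* For a subfunctor of groups `Ψ ⊆ Φ^gp` (`GpSubfunctor`; `Ψ = Φ^birat` in the text):
  `GpSubfunctor.dataHomOfLE` (data morphism `(Φ, Ψ) → (Φ', Ψ')` from `η` with `η^gp(Ψ) ⊆ Ψ'`),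
  `GpSubfunctor.toPerfectionData` (`(Φ, Ψ) → (Φ^pf, Ψ^pf)`), `RealificationData.ofBaseData`
  (`(Φ, Ψ) → (Φ^rlf, ℝ · Ψ)`), hence the functors `Ψ.ModelOf ⥤ Ψ.PfModelOf` and
  `Ψ.ModelOf ⥤ R.RlfModelOf Ψ` — for `Ψ = Φ^birat`: `C^un-tr → (C^un-tr)^pf` and `C^un-tr → C^rlf` in their
  model descriptions (Prop. 5.3).
Multiplicative rendering as in `ModelFrobenioid.lean` (`M^gp = Algebra.GrothendieckGroup M`).
-/

namespace Literature.AlgebraicGeometry.Frobenioids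

open CategoryTheory Opposite

universe w v u

variable {D : Type u} [Category.{v} D]

/-! ### `η^gp` for a homomorphism `η : Φ → Φ'` of monoids on `D` -/

/-- `η^gp_A : Φ(A)^gp → Φ'(A)^gp`, the groupification of the component at `A` of a homomorphism
`η : Φ → Φ'` of monoids on `D` (§0 p. 11: groupification is functorial).
[cite: MochizukiFrdI2008, Def. 1.1 (ii) p.19] -/
noncomputable abbrev gpApp {Φ Φ' : Dᵒᵖ ⥤ CommMonCat.{w}} (η : Φ ⟶ Φ') (A : Dᵒᵖ) :
    Algebra.GrothendieckGroup (Φ.obj A) →* Algebra.GrothendieckGroup (Φ'.obj A) :=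
  MonGp.map (η.app A).hom

/-- `η^gp` extends `η`. [cite: MochizukiFrdI2008, Def. 1.1 (ii) p.19] -/
theorem gpApp_of {Φ Φ' : Dᵒᵖ ⥤ CommMonCat.{w}} (η : Φ ⟶ Φ') (A : Dᵒᵖ) (a : Φ.obj A) :
    gpApp η A (Algebra.GrothendieckGroup.of a) = Algebra.GrothendieckGroup.of ((η.app A).hom a) :=
  MonGp.map_of _ a

/-- `η^gp` commutes with the pull-back maps (naturality of `η`, groupified).
[cite: MochizukiFrdI2008, Def. 1.1 (ii) p.19] -/
theorem gpApp_pullGp {Φ Φ' : Dᵒᵖ ⥤ CommMonCat.{w}} (η : Φ ⟶ Φ') {X Y : D} (f : X ⟶ Y)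
    (c : Algebra.GrothendieckGroup (Φ.obj (op Y))) :
    gpApp η (op X) (pullGp Φ f c) = pullGp Φ' f (gpApp η (op Y) c) := by
  have key : (gpApp η (op X)).comp (pullGp Φ f) = (pullGp Φ' f).comp (gpApp η (op Y)) := by
    apply MonGp.hom_ext
    intro a
    have h := congrArg (fun g => (CommMonCat.Hom.hom g) a) (η.naturality f.op)
    simp only [MonoidHom.comp_apply, gpApp, pullGp, MonGp.map_of]
    exact congrArg Algebra.GrothendieckGroup.of h
  exact DFunLike.congr_fun key c

namespace ModelFrobenioid

variable {Φ B Φ' B' : Dᵒᵖ ⥤ CommMonCat.{w}}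

/-- A *morphism of model data* `(Φ, B, Div_B) → (Φ', B', Div_B')` (the shape of the maps
`Φ → Φ^pf → Φ^rlf`, `Φ^birat → (Φ^birat)^pf → ℝ · Φ^birat` behind the "natural functors" of Prop. 5.3
p. 103): homomorphisms `η : Φ → Φ'`, `β : B → B'` of monoids on `D` with `Div_B' ∘ β = η^gp ∘ Div_B`.
[cite: MochizukiFrdI2008, Prop. 5.3 p.103] -/
structure DataHom (DivB : B ⟶ monoidGp Φ) (DivB' : B' ⟶ monoidGp Φ') where
  /-- `η : Φ → Φ'` -/
  η : Φ ⟶ Φ'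
  /-- `β : B → B'` -/
  β : B ⟶ B'
  /-- `Div_B'(β(u)) = η^gp(Div_B(u))` -/
  comm : ∀ (A : Dᵒᵖ) (u : B.obj A),
    gpApp η A (divB Φ B DivB A u) = divB Φ' B' DivB' A ((β.app A).hom u)

namespace DataHom

variable {DivB : B ⟶ monoidGp Φ} {DivB' : B' ⟶ monoidGp Φ'} (h : DataHom DivB DivB')

/-- The image `(d, f, η(Div φ), β(u_φ))` of a morphism `φ = (d, f, Div φ, u_φ)` of model Frobenioids;
relation (d) of Thm. 5.2 (i) is transported by `η^gp` (PROVED). [cite: MochizukiFrdI2008, Thm. 5.2 (i) p.100] -/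
noncomputable def mapHom {X Y : ModelFrobenioid Φ B DivB} (φ : X ⟶ Y) :
    ModelFrobenioid.Hom (⟨X.base, gpApp h.η (op X.base) X.cls⟩ : ModelFrobenioid Φ' B' DivB')
      ⟨Y.base, gpApp h.η (op Y.base) Y.cls⟩ where
  degFr := Hom.degFr (X := X) (Y := Y) φ
  base := Hom.base (X := X) (Y := Y) φ
  div := (h.η.app (op X.base)).hom (Hom.div (X := X) (Y := Y) φ)
  unit := (h.β.app (op X.base)).hom (Hom.unit (X := X) (Y := Y) φ)
  rel := by
    have hr := congrArg (gpApp h.η (op X.base)) (Hom.rel (X := X) (Y := Y) φ)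
    rw [map_mul, map_pow, gpApp_of, map_mul, gpApp_pullGp, h.comm] at hr
    exact hr

/-- **The functor of model Frobenioids induced by a morphism of model data**:
`(A_D, α) ↦ (A_D, η^gp(α))`, `(d, f, Div, u) ↦ (d, f, η(Div), β(u))` ("the functors that arise
naturally from the construction", Prop. 5.3 p. 103; functoriality PROVED).
[cite: MochizukiFrdI2008, Prop. 5.3 p.103] -/
noncomputable def functor : ModelFrobenioid Φ B DivB ⥤ ModelFrobenioid Φ' B' DivB' where
  obj X := ⟨X.base, gpApp h.η (op X.base) X.cls⟩
  map φ := h.mapHom φ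
  map_id X := by
    apply hom_ext
    · rfl
    · rfl
    · exact map_one (h.η.app (op X.base)).hom
    · exact map_one (h.β.app (op X.base)).hom
  map_comp {X Y Z} φ ψ := by
    apply hom_ext
    · rfl
    · rfl
    · change (h.η.app (op X.base)).hom ((Φ.map (Hom.base φ).op).hom (Hom.div ψ) *
          Hom.div φ ^ (Hom.degFr ψ : ℕ)) =
        (Φ'.map (Hom.base φ).op).hom ((h.η.app (op Y.base)).hom (Hom.div ψ)) *
          (h.η.app (op X.base)).hom (Hom.div φ) ^ (Hom.degFr ψ : ℕ)
      have hn := congrArg (fun g => (CommMonCat.Hom.hom g) (Hom.div ψ)) (h.η.naturality (Hom.base φ).op)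
      rw [map_mul, map_pow]
      exact congrArg (· * _) hn
    · change (h.β.app (op X.base)).hom ((B.map (Hom.base φ).op).hom (Hom.unit ψ) *
          Hom.unit φ ^ (Hom.degFr ψ : ℕ)) =
        (B'.map (Hom.base φ).op).hom ((h.β.app (op Y.base)).hom (Hom.unit ψ)) *
          (h.β.app (op X.base)).hom (Hom.unit φ) ^ (Hom.degFr ψ : ℕ)
      have hn := congrArg (fun g => (CommMonCat.Hom.hom g) (Hom.unit ψ)) (h.β.naturality (Hom.base φ).op)
      rw [map_mul, map_pow]
      exact congrArg (· * _) hn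

/-- Compatibility with the functors to the elementary Frobenioids: the induced functor followed by
`C' → F_{Φ'}` is `C → F_Φ` followed by the functor `F_Φ → F_{Φ'}` induced by `η`
(`ElemFrobenioid.mapNatTrans`). [cite: MochizukiFrdI2008, Prop. 5.3 p.103] -/
noncomputable def functorCompToElem :
    h.functor ⋙ toElem Φ' B' DivB' ≅ toElem Φ B DivB ⋙ ElemFrobenioid.mapNatTrans h.η :=
  NatIso.ofComponents (fun X => eqToIso rfl) (fun φ => by
    erw [Category.comp_id, Category.id_comp]
    exact ElemFrobenioid.Hom.ext rfl rfl rfl)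

end DataHom

end ModelFrobenioid

/-! ### The data morphisms of Proposition 5.3 for a subfunctor of groups `Ψ ⊆ Φ^gp` -/

namespace GpSubfunctor

variable {Φ Φ' : Dᵒᵖ ⥤ CommMonCat.{w}} (Ψ : GpSubfunctor Φ) (Ψ' : GpSubfunctor Φ')

/-- A homomorphism `η : Φ → Φ'` with `η^gp(Ψ) ⊆ Ψ'` gives a morphism of model data
`(Φ, Ψ, Ψ ↪ Φ^gp) → (Φ', Ψ', Ψ' ↪ Φ'^gp)`. [cite: MochizukiFrdI2008, Prop. 5.3 p.103] -/
noncomputable def dataHomOfLE (η : Φ ⟶ Φ')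
    (hη : ∀ (X : D) (c : Algebra.GrothendieckGroup (Φ.obj (op X))),
      c ∈ Ψ.carrier X → gpApp η (op X) c ∈ Ψ'.carrier X) :
    ModelFrobenioid.DataHom Ψ.incl Ψ'.incl where
  η := η
  β :=
    { app := fun X => CommMonCat.ofHom
        (((gpApp η X).comp (Ψ.carrier (unop X)).subtype).codRestrict (Ψ'.carrier (unop X))
          fun c => hη (unop X) c.1 c.2)
      naturality := fun X Y f => by
        apply CommMonCat.hom_ext
        apply MonoidHom.ext
        intro c
        apply Subtype.ext
        exact gpApp_pullGp η f.unop c.1 }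
  comm _ _ := rfl

/-- `(Φ, Ψ) → (Φ^pf, Ψ^pf)`: the data morphism along `Φ → Φ^pf` (every `c ∈ Ψ` has its image in
`Ψ^pf = ℚ · Ψ`, exponent `1`). [cite: MochizukiFrdI2008, Prop. 5.3 p.103] -/
noncomputable def toPerfectionData : ModelFrobenioid.DataHom Ψ.incl Ψ.perfection.incl :=
  Ψ.dataHomOfLE Ψ.perfection (toPerfectionFunctor Φ) fun X c hc =>
    ⟨1, by rw [PNat.one_coe, pow_one]; exact ⟨c, hc, rfl⟩⟩

/-- The functor "model of `(Φ, Ψ)` → model of `(Φ^pf, Ψ^pf)`" — for `Ψ = Φ^birat`: `C^un-tr → (C^un-tr)^pf`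
in the model description of Prop. 5.3. [cite: MochizukiFrdI2008, Prop. 5.3 p.103] -/
noncomputable abbrev toPfModel : Ψ.ModelOf ⥤ Ψ.PfModelOf := Ψ.toPerfectionData.functor

end GpSubfunctor

namespace RealificationData

variable {Φ : Dᵒᵖ ⥤ CommMonCat.{w}} (R : RealificationData Φ) (Ψ : GpSubfunctor Φ)

/-- `ι(c) ∈ ℝ · Ψ(X)` for `c ∈ Ψ(X)` (the generator with `r = 1`).
[cite: MochizukiFrdI2008, Prop. 5.3 p.103] -/
theorem toRlfGp_mem_realSpan (X : D) {c : Algebra.GrothendieckGroup (Φ.obj (op X))}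
    (hc : c ∈ Ψ.carrier X) : R.toRlfGp X c ∈ (R.realSpan Ψ).carrier X :=
  Subgroup.subset_closure ⟨1, c, hc, (R.rsmul_one X _).symm⟩

/-- `(Φ, Ψ) → (Φ^rlf, ℝ · Ψ)`: the data morphism along `Φ → Φ^rlf`.
[cite: MochizukiFrdI2008, Prop. 5.3 p.103] -/
noncomputable def ofBaseData : ModelFrobenioid.DataHom Ψ.incl (R.realSpan Ψ).incl :=
  Ψ.dataHomOfLE (R.realSpan Ψ) R.toRlf fun X _ hc => R.toRlfGp_mem_realSpan Ψ X hc

/-- The functor "model of `(Φ, Ψ)` → model of `(Φ^rlf, ℝ · Ψ)`" — for `Ψ = Φ^birat`: `C^un-tr → C^rlf`,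
the composite of the bottom row of the diagram of Prop. 5.3 in the model descriptions.
[cite: MochizukiFrdI2008, Prop. 5.3 p.103] -/
noncomputable abbrev toRlfModel : Ψ.ModelOf ⥤ R.RlfModelOf Ψ := (R.ofBaseData Ψ).functor

end RealificationData

end Literature.AlgebraicGeometry.Frobenioids
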